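import Summits.ResolutionOfSingularities.ResolutionOfSingularities.Theorems.MarkedTransferCampaignW46MohWindowShadePSPhase
import Summits.ResolutionOfSingularities.ResolutionOfSingularities.Theorems.MarkedTransferCampaignW46MohWindowShadeFormalBranch
import HarnessLib

/-!
# [OURS · L1 W4.6] Rung (iii) "Moh window", power-series residuals, surfaces — THE FORMAL `p`-FOLD BRANCH OF AN
  INFINITE WALK: the model theorem of the power-series port (proofs only)

Cell `res-hironaka`, rung L, slot W4.6, seat `res-L1-s46-pv-6` (gen 6).  `--kind proof --supports
stmt-ResolutionOfSingularities-16155 --as helper`.  `…MohWindowShadeFormalBranch` (gen 3) for SERIES states: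
the limit factorisation (`Series.exists_powerSeries_factor`: `F ≡ (y_i − ψ_k)^p · w_k` modulo degree `≥ o + k` for
every `k` ⟹ `F = (y_i − ψ)^p · W` in `K⟦y⟧`, `ψ` the digit series) and THE MODEL THEOREM OF THE PORT
(HOME/L/res-L1-s46-pv-6/GENERAL-REGIME-ANALYSIS.md §6 (d)):

`Series.exists_coordinate_or_digit_curve_of_walk` — every infinite walk of point blow-ups of `x^p + F(y_j, y_i)`,
`F ∈ K⟦y_j, y_i⟧` A POWER SERIES, in the Hauser–Wagner frame, cleaned start with `y^r ∣ F`, every step equimultiple,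
every state in the window `p ≤ ord F_n < 2p`, reaches a stage `n` with `F_n = y_l^p · W` or `F_n = (y_i − ψ(y_j))^p · W`,
`ψ = Σ_k t_{n+k} y_j^{k+1}` the digit series of the LATER POINTS of the walk: the walk meets a formal curve of `p`-fold
points.  Contrapositive: off formal `p`-fold curves every such walk is FINITE.  This is the residual-SERIES form of the
termination of the classical pair in regime (iii) of RESCUE-SEED W4.6 (the formally-polynomial case was gen 3/5).
OURS; NOT a statement of the manuscript [claim: Hironaka2017, status: under-review], nothing of which is used.  AI
review is weaker than expert review.
-/

noncomputable section

set_option linter.dupNamespace false -- mandated namespace of this single-conjunct summit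

open MvPolynomial Finset

namespace Summit.ResolutionOfSingularities.ResolutionOfSingularities.Theorems.CampaignW46.MohWindowShadePS

open Literature.AlgebraicGeometry.Resolution
open Literature.AlgebraicGeometry.Resolution.PointBlowup
open Literature.AlgebraicGeometry.Resolution.Hauser2010
open Literature.Barriers.ResolutionOfSingularities (ordZero_le_of_coeff_ne_zero le_ordZero_of_forall)
open MohWindowShadeCleaning (eq_single_add_single degree_eq_add)
open MohWindowShadeFormalBranch (ordZero_mul ordZero_pow coeff_eq_zero_of_degree_lt digitSeries coeff_digitSeries
  le_ordZero_digits_sub ordZero_X_sub_digits coeff_mul_eq_of_forall coeff_pow_eq_of_forall)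

variable {σ : Type*} {K : Type*} [Field K] [Fintype σ] [DecidableEq σ] [DecidableEq K]
variable (p : ℕ) [hp : Fact p.Prime] [CharP K p]

/-! ## §1 Orders in `K⟦y⟧` -/

omit [Fintype σ] [DecidableEq σ] [DecidableEq K] hp [CharP K p] in
/-- The order of a sum is at least the lesser order (series). [folklore] -/
theorem le_order_add {A B : MvPowerSeries σ K} {n : ℕ∞} (hA : n ≤ A.order) (hB : n ≤ B.order) :
    n ≤ (A + B).order :=
  le_trans (le_min hA hB) MvPowerSeries.min_order_le_add

omit [Fintype σ] [DecidableEq σ] [DecidableEq K] in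
/-- **[OURS · L1 W4.6] Cofactors stabilise (series residual).**  If `F ≡ h^p·w` and `F ≡ h'^p·w'` modulo degree
`≥ N` in `K⟦y⟧`, with polynomials `h, h', w, w'`, `ord h = 1` and `ord(h − h') ≥ M`, then
`ord(w − w') ≥ min(p·M, N) − p`.  NOT a statement of the manuscript. [folklore] -/
theorem le_ordZero_sub_cofactor_series {F : MvPowerSeries σ K} {h h' w w' : MvPolynomial σ K}
    (hh : ordZero h = 1) {N M : ℕ}
    (hF : (N : ℕ∞) ≤ (F - ((h ^ p * w : MvPolynomial σ K) : MvPowerSeries σ K)).order)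
    (hF' : (N : ℕ∞) ≤ (F - ((h' ^ p * w' : MvPolynomial σ K) : MvPowerSeries σ K)).order)
    (hδ : (M : ℕ∞) ≤ ordZero (h - h')) :
    ((min (p * M) N - p : ℕ) : ℕ∞) ≤ ordZero (w - w') := by
  set L := min (p * M) N with hL
  -- the identity, in `K⟦y⟧`
  have hid : ((h ^ p * (w - w') : MvPolynomial σ K) : MvPowerSeries σ K) =
      (F - ((h' ^ p * w' : MvPolynomial σ K) : MvPowerSeries σ K)) +
        -(F - ((h ^ p * w : MvPolynomial σ K) : MvPowerSeries σ K)) +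
        -(((h - h') ^ p * w' : MvPolynomial σ K) : MvPowerSeries σ K) := by
    have hpoly : h ^ p * (w - w') = h ^ p * w - h' ^ p * w' - (h - h') ^ p * w' := by
      rw [sub_pow_char h h']; ring
    rw [hpoly]
    simp only [← MvPolynomial.coeToMvPowerSeries.ringHom_apply, map_sub, map_mul]
    ring
  have h1 : (L : ℕ∞) ≤ ordZero (h ^ p * (w - w')) := by
    unfold ordZero
    rw [hid]
    refine le_order_add (le_order_add ?_ ?_) ?_
    · exact le_trans (by exact_mod_cast min_le_right _ _) hF'
    · rw [MvPowerSeries.order_neg]; exact le_trans (by exact_mod_cast min_le_right _ _) hF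
    · rw [MvPowerSeries.order_neg]
      show (L : ℕ∞) ≤ ordZero ((h - h') ^ p * w')
      rw [ordZero_mul, ordZero_pow]
      calc ((L : ℕ) : ℕ∞) ≤ ((p * M : ℕ) : ℕ∞) := by exact_mod_cast min_le_left _ _
        _ = (p : ℕ∞) * (M : ℕ∞) := by push_cast; rfl
        _ ≤ (p : ℕ∞) * ordZero (h - h') := mul_le_mul_right hδ _
        _ ≤ (p : ℕ∞) * ordZero (h - h') + ordZero w' := le_self_add
  rw [ordZero_mul, ordZero_pow, hh, mul_one] at h1
  by_cases htop : ordZero (w - w') = ⊤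
  · rw [htop]; exact le_top
  · obtain ⟨x, hx⟩ := ENat.ne_top_iff_exists.mp htop
    rw [← hx] at h1 ⊢
    have h2 : L ≤ p + x := by exact_mod_cast h1
    exact_mod_cast (by omega : L - p ≤ x)

/-! ## §2 The limit factorisation for a series residual -/

section TwoLetters

variable {j i : σ}

omit [DecidableEq K] in
/-- **[OURS · L1 W4.6] THE LIMIT: an honest factorisation in `K⟦y_j, y_i⟧` (series residual).**  Two letters, `p < o`.
If a SERIES `F` satisfies, for every `k`, `ord(F − (y_i − ψ_k(y_j))^p · w_k) ≥ o + k` for some polynomial `w_k`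
(`ψ_k` the truncations of the digit series `ψ = Σ_k t_k y_j^{k+1}`), then `F = (y_i − ψ(y_j))^p · W` for a power series
`W`.  NOT a statement of the manuscript. [folklore] -/
theorem Series.exists_powerSeries_factor (hij : i ≠ j) (htwo : ∀ l, l = j ∨ l = i) {F : MvPowerSeries σ K}
    (t : ℕ → K) {o : ℕ} (hpo : p < o)
    (hk : ∀ k, ∃ w : MvPolynomial σ K, ((o + k : ℕ) : ℕ∞) ≤
      (F - (((X i - ∑ k' ∈ Finset.range k, C (t k') * X j ^ (k' + 1)) ^ p * w : MvPolynomial σ K) :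
        MvPowerSeries σ K)).order) :
    ∃ W : MvPowerSeries σ K, F = (MvPowerSeries.X i - digitSeries j i t) ^ p * W := by
  classical
  choose w hw using hk
  set ψ : ℕ → MvPolynomial σ K := fun k => ∑ k' ∈ Finset.range k, C (t k') * X j ^ (k' + 1) with hψ
  -- stabilisation: the coefficients of degree `≤ k` of `w k` and `w k'` agree (`1 ≤ k ≤ k'`)
  have hstab : ∀ k k', 1 ≤ k → k ≤ k' → ∀ e : σ →₀ ℕ, e.degree ≤ k → coeff e (w k) = coeff e (w k') := by
    intro k k' hk1 hkk' e he
    have h1 := le_ordZero_sub_cofactor_series p (ordZero_X_sub_digits hij t k) (hw k)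
      (le_trans (by exact_mod_cast (by omega : o + k ≤ o + k')) (hw k')) (le_ordZero_digits_sub t hkk')
    have hp2 : 2 ≤ p := hp.out.two_le
    have hmin : k + 1 ≤ min (p * (k + 1)) (o + k) - p := by
      have : p * (k + 1) = p * k + p := by ring
      have : 2 * k ≤ p * k := Nat.mul_le_mul_right k hp2
      omega
    have h2 : ((k + 1 : ℕ) : ℕ∞) ≤ ordZero (w k - w k') := le_trans (by exact_mod_cast hmin) h1
    have h3 := coeff_eq_zero_of_degree_lt h2 (d := e) (by omega)
    rw [coeff_sub, sub_eq_zero] at h3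
    exact h3
  refine ⟨fun e => coeff e (w (e.degree + 1)), ?_⟩
  ext e
  set N := e.degree with hN
  set k := N + 1 with hkdef
  -- left: `coeff e F = coeff e (h_k^p w_k)`
  have hL : MvPowerSeries.coeff e F = coeff e ((X i - ψ k) ^ p * w k) := by
    have h0 : MvPowerSeries.coeff e (F - (((X i - ψ k) ^ p * w k : MvPolynomial σ K) : MvPowerSeries σ K)) = 0 :=
      MvPowerSeries.coeff_of_lt_order (lt_of_lt_of_le (by exact_mod_cast (by omega : N < o + k)) (hw k))
    rw [map_sub, sub_eq_zero, MvPolynomial.coeff_coe] at h0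
    exact h0
  rw [hL, ← MvPolynomial.coeff_coe, MvPolynomial.coe_mul, MvPolynomial.coe_pow]
  symm
  refine coeff_mul_eq_of_forall (N := N) (coeff_pow_eq_of_forall (N := N) (fun a ha => ?_) p) (fun a ha => ?_)
    le_rfl
  · -- `H` and `h_k` agree below degree `N`
    rw [map_sub, MvPowerSeries.coeff_X, coeff_digitSeries, ← coeToMvPowerSeries.ringHom_apply, map_sub,
      coeToMvPowerSeries.ringHom_apply, coeToMvPowerSeries.ringHom_apply, map_sub, MvPolynomial.coeff_coe,
      MvPolynomial.coeff_coe, coeff_X, hψ]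
    simp only
    rw [coeff_sum]
    congr 1
    · by_cases h : a = Finsupp.single i 1
      · rw [if_pos h, if_pos h.symm]
      · rw [if_neg h, if_neg (Ne.symm h)]
    · by_cases hc : a i = 0 ∧ 1 ≤ a j
      · rw [if_pos hc]
        have ha' : Finsupp.single j (a j - 1 + 1) = a := by
          rw [Nat.sub_add_cancel hc.2]
          conv_rhs => rw [eq_single_add_single hij htwo a, hc.1, Finsupp.single_zero, add_zero]
        rw [Finset.sum_eq_single (a j - 1)]
        · rw [coeff_C_mul, coeff_X_pow, if_pos ha', mul_one]
        · intro n _ hn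
          rw [coeff_C_mul, coeff_X_pow, if_neg, mul_zero]
          intro h
          apply hn
          have := DFunLike.congr_fun h j
          rw [Finsupp.single_eq_same] at this
          omega
        · intro hn
          exfalso
          rw [Finset.mem_range, not_lt] at hn
          rw [degree_eq_add hij htwo a] at ha
          omega
      · rw [if_neg hc]
        symm
        refine Finset.sum_eq_zero fun n hn => ?_
        rw [coeff_C_mul, coeff_X_pow, if_neg, mul_zero]
        intro h
        apply hc
        rw [← h, Finsupp.single_eq_of_ne hij, Finsupp.single_eq_same]
        exact ⟨rfl, by omega⟩
  · -- `W` and `w_k` agree below degree `N`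
    rw [MvPowerSeries.coeff_apply, MvPolynomial.coeff_coe]
    exact hstab (a.degree + 1) k (by omega) (by omega) a (by omega)

/-! ## §3 The model theorem of the power-series port -/

omit [Fintype σ] [DecidableEq σ] [DecidableEq K] hp [CharP K p] in
/-- A series all of whose monomials are divisible by `y_l^p` is `y_l^p · W`. [folklore] -/
theorem exists_eq_X_pow_mul_of_forall_le {F : MvPowerSeries σ K} {l : σ}
    (h : ∀ d : σ →₀ ℕ, MvPowerSeries.coeff d F ≠ 0 → p ≤ d l) :
    ∃ W : MvPowerSeries σ K, F = MvPowerSeries.X l ^ p * W := by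
  classical
  refine ⟨fun d => MvPowerSeries.coeff (d + Finsupp.single l p) F, ?_⟩
  ext e
  rw [MvPowerSeries.X_pow_eq, MvPowerSeries.coeff_monomial_mul]
  split_ifs with hle
  · simp only [MvPowerSeries.coeff_apply, one_mul]
    rw [tsub_add_cancel_of_le hle]
  · by_contra hne
    exact hle (Finsupp.single_le_iff.mpr (h e hne))

/-- **[OURS · L1 W4.6] RUNG (iii), SURFACES, POWER-SERIES RESIDUALS — THE FORMAL `p`-FOLD CURVE MET BY AN INFINITE
IN-WINDOW WALK is EITHER a coordinate axis OR the digit branch** (`…FormalBranch.exists_coordinate_or_digit_curve_of_walk`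
for series states — THE MODEL THEOREM OF THE POWER-SERIES PORT).  Let `S₀, S₁, …` be an infinite walk
`S_{n+1} = step p (c n) (b n) (S n)` of point blow-ups of the surface `x^p + F(y_j, y_i)`, `F ∈ K⟦y_j, y_i⟧` a POWER
SERIES, presented in the Hauser–Wagner frame (chart `c n ∈ {j, i}`, `b n (c n) = 0`, `b n = 0` when `c n = i`), from a
cleaned series state with `y^r ∣ F`, every step EQUIMULTIPLE, every state inside the window `p ≤ ord F_n < 2p`.  Then at
some stage `n` either `F_n = y_l^p · W` for a letter `l` (the coordinate curve `y_l = 0` is `p`-fold), or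
`F_n = (y_i − ψ(y_j))^p · W` with `ψ = digitSeries j i t` the digit series of the LATER POINTS OF THE WALK,
`t k = b (n + k) i`.  Contrapositive: off formal `p`-fold curves every such walk is FINITE.  Replaces, for regime (iii)
of RESCUE-SEED W4.6 read with residual SERIES (the purely inseparable surface `z^p = F(x, y)`, `F` a power series,
`p < ord F < 2p`), the classical pair, the ROLE of the termination clause of Th. 16.13 (ms. p. 87 l. 25–29); NOT a
statement of the manuscript. [folklore] -/
theorem Series.exists_coordinate_or_digit_curve_of_walk (hij : i ≠ j) (htwo : ∀ l, l = j ∨ l = i)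
    (S : ℕ → Series σ K) (c : ℕ → σ) (b : ℕ → σ → K) (hb : ∀ n, b n (c n) = 0)
    (hHW : ∀ n, c n = i → ∀ l, b n l = 0) (hstep : ∀ n, S (n + 1) = (S n).step p (c n) (b n))
    (hclean : IsClean p (S 0).F) (hr : Divides (S 0).r (S 0).F)
    (heq : ∀ n, (S n).IsEquimultiplePoint p (c n) (b n))
    (hwin : ∀ n, (p : ℕ∞) ≤ (S n).F.order ∧ (S n).F.order < (2 * p : ℕ)) :
    ∃ n, (∃ (l : σ) (W : MvPowerSeries σ K), (S n).F = MvPowerSeries.X l ^ p * W) ∨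
      ∃ W : MvPowerSeries σ K,
        (S n).F = (MvPowerSeries.X i - digitSeries j i (fun k => b (n + k) i)) ^ p * W := by
  classical
  obtain ⟨n, hn⟩ := Series.formal_branch_of_walk p hij htwo S c b hb hHW hstep hclean hr heq hwin
  refine ⟨n, ?_⟩
  rcases hn with ⟨l, hl⟩ | hbranch
  · exact Or.inl ⟨l, exists_eq_X_pow_mul_of_forall_le p hl⟩
  · right
    have hinv := Series.invariants_of_walk p hij htwo S c b hb hstep hclean hr heq hwin n
    obtain ⟨o, ho, hlo, -⟩ := hinv.2.2
    have hk : ∀ k, ∃ w : MvPolynomial σ K, ((o + k : ℕ) : ℕ∞) ≤ ((S n).F -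
        (((X i - ∑ k' ∈ Finset.range k, C (b (n + k') i) * X j ^ (k' + 1)) ^ p * w : MvPolynomial σ K) :
          MvPowerSeries σ K)).order := by
      intro k
      obtain ⟨w, hw⟩ := hbranch k
      exact ⟨w, by rw [ho] at hw; exact_mod_cast hw⟩
    exact Series.exists_powerSeries_factor p hij htwo (fun k' => b (n + k') i) hlo hk

/-- **[OURS · L1 W4.6] RUNG (iii), SURFACES, POWER-SERIES RESIDUALS — TERMINATION, FINAL FORM: every infinite
in-window walk meets a FORMAL CURVE OF `p`-FOLD POINTS** (`…FormalBranch.exists_formal_pfold_curve_of_walk` for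
series states): under the hypotheses of `Series.exists_coordinate_or_digit_curve_of_walk`, for some `n` the residual
SERIES `F_n` is divisible in `K⟦y_j, y_i⟧` by the `p`-th power of a SMOOTH formal curve germ: `F_n = h^p · W` with
`h(0) = 0` and some `∂h/∂y_l(0) ≠ 0`.  NOT a statement of the manuscript. [folklore] -/
theorem Series.exists_formal_pfold_curve_of_walk (hij : i ≠ j) (htwo : ∀ l, l = j ∨ l = i)
    (S : ℕ → Series σ K) (c : ℕ → σ) (b : ℕ → σ → K) (hb : ∀ n, b n (c n) = 0)
    (hHW : ∀ n, c n = i → ∀ l, b n l = 0) (hstep : ∀ n, S (n + 1) = (S n).step p (c n) (b n))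
    (hclean : IsClean p (S 0).F) (hr : Divides (S 0).r (S 0).F)
    (heq : ∀ n, (S n).IsEquimultiplePoint p (c n) (b n))
    (hwin : ∀ n, (p : ℕ∞) ≤ (S n).F.order ∧ (S n).F.order < (2 * p : ℕ)) :
    ∃ (n : ℕ) (h W : MvPowerSeries σ K), MvPowerSeries.constantCoeff h = 0 ∧
      (∃ l, MvPowerSeries.coeff (Finsupp.single l 1) h ≠ 0) ∧ (S n).F = h ^ p * W := by
  classical
  obtain ⟨n, hn⟩ := Series.exists_coordinate_or_digit_curve_of_walk p hij htwo S c b hb hHW hstep hclean hr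
    heq hwin
  rcases hn with ⟨l, W, hW⟩ | ⟨W, hW⟩
  · refine ⟨n, MvPowerSeries.X l, W, MvPowerSeries.constantCoeff_X l, ⟨l, ?_⟩, hW⟩
    rw [MvPowerSeries.coeff_index_single_self_X]; exact one_ne_zero
  · refine ⟨n, MvPowerSeries.X i - digitSeries j i (fun k => b (n + k) i), W, ?_, ⟨i, ?_⟩, hW⟩
    · rw [map_sub, MvPowerSeries.constantCoeff_X, zero_sub, neg_eq_zero,
        ← MvPowerSeries.coeff_zero_eq_constantCoeff, coeff_digitSeries, if_neg]
      simp
    · rw [map_sub, MvPowerSeries.coeff_index_single_self_X, coeff_digitSeries, if_neg]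
      · simp
      · rw [Finsupp.single_eq_same]; omega

end TwoLetters

end Summit.ResolutionOfSingularities.ResolutionOfSingularities.Theorems.CampaignW46.MohWindowShadePS
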